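import Summits.QuantumFields.BalabanUV.Beta.D1BFx.GradedBubbleTerms
import Summits.QuantumFields.BalabanUV.Beta.D1BFx.ScaleLegTermCount
import Literature.MathematicalPhysics.QuantumFieldTheory.Balaban1983to89.Beta.DecimatedMomentSummable

/-!
# `BalabanUV.Beta.D1BFx.ScaleLegTermBound` — road «BF-x» for binder row D1, «A3.c ∕ L-X TAILS» part (C2): ONE ADMISSIBLE weighted elementary term
# `P(w)·c·(∂^{as₁}g)(x−w)·(∂^{as₂}g)(w+y)` through a scale-`n` profile is summable and has `|fullSum|`, `|Σ'|` bounded UNIFORMLY IN `n`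

HONEST DEPENDENCY (page 1, mandatory): continuum YM on T⁴ ⇐ BetaPertH ∧ nine spine estimates (0/9 proved); BetaPertH ⇐ (D1) ∧ (D4) ∧
CAP+tail; G-an2-4 gates asym, D1 and NE2/3/4.  HONEST FRAMING (cell contract, verbatim): «discharging `BetaPertH` makes Bałaban's UV
stability UNCONDITIONAL — a real constructive-QFT result; it is NOT the continuum limit and NOT the Clay problem.»  THIS MODULE DISCHARGES
NOTHING of the wall: [folklore] composition BY NAME of part (A) `GradedBubbleTerms` (`ETerm.eval`, `iterD_add∕append∕isO`), part (B) `ScaleLegRows`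
(the legs from the END's rows d0∕d1∕h0∕h1), part (C1) `ScaleLegTermCount` (the count and the per-point forms), an3's `GradedBubbles.dg_three_free` (the free
anchor, a theorem) and `DecimatedMomentSummable.absMoment₂_of_decay510` (fixed-`n` summability).  The profile `g` is an ARBITRARY function under the
four rows; nothing about Bałaban's kernels is asserted; no `def`, no `Prop` minted, nothing cited, 0 sorry.  0 wall binders; NOT the L-X row, NOT A3.c,
NOT (K), NOT D1, NOT `BetaPertH`, NOT continuum, NOT Clay.

ABSOLUTE RULE (cell charter, verbatim): «No internally-minted statement may enter as a cited fact. Every hypothesis is either kernel-proved in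
this package or a verbatim quotation of a PUBLISHED theorem with page reference. The manuscript(s) under audit are NOT citable for their own
disputed steps — they are the thing under adjudication; programme-internal (2001/route/tribunal) claims are never citable.»

WHY (owner d1-p2-g9 RULINGS ρ-g9-31∕32; this lineage's N-d1leaf03g12-1, journal l.29701): the per-term engine of the re-cut (β′) — d0∕d1 (far, printed via
`FrozenLegTails`) + h0∕h1 (window, unconditional) + the free anchor, NO third and NO single-leg second difference row, NO shell row.
* §1 [folklore] THE LEGS IN UNIFORM SHAPE: `abs_iterD_far_le` (`(5A₀+8A₁+|gFree 0|+D₀)·8e^δ(1+8e^δ)^k·E(u)/(‖u‖∞+1)^{2+min k 1}`), `abs_iterD_flat_le`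
  (`(D₀+D₁)2^k/n^{2+min k 1}`), `exists_soft_iterD_free` (`A/(‖u‖∞+1)^{2+min k 3}`, from `dg_three_free`), `iterD_const_eq_free_add_flat`.
* §2 [folklore] SUMMABILITY at fixed `n`: `l1_le_l1_sub_add`, `l1_le_l1_add_add`, `summable_weighted_of_envelopes`, `summable_weight_eval`.
* §3 [folklore] **`exists_bound_weight_eval`**: for ADMISSIBLE `(m, t)` (`m ≤ min(|as₁|,1) + min(|as₂|,1)`, `m + 1 ≤ |as₁| + |as₂|`, `m ≤ 2`) and constants
  `(Cp, δ, A₀, A₁, D₀, D₁)` ONE `B ≥ 0` with, for every `n ≥ 1`, every `g` obeying the four rows at scale `n`, every weight `|P w| ≤ Cp(‖w‖∞+1)^m`: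
  summable, `|fullSum| ≤ B`, `|Σ'| ≤ B`.
Unit `b2b-balaban-beta-d1-formalise-leaf-03` (gen 12), D1 formalisation swarm; `LEAVES-BFx.md` row «A3.c ∕ L-X TAILS» part (C2).
-/

noncomputable section

namespace Summit.QuantumFields.BalabanUV.Beta.D1BFx.ScaleLegTermBound

open Finset Filter Topology
open scoped BigOperators
open Literature.Probability.LatticeModels (annulus)
open Literature.MathematicalPhysics.QuantumFieldTheory.Balaban1983to89
open Literature.MathematicalPhysics.QuantumFieldTheory.Balaban1983to89.Beta
open B12Sec2to5 (l1 l1_nonneg abs_coord_le_l1 Decay510)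
open DyadicShell (Pt supNorm supNorm_eq_zero_iff supNorm_eq_of_mem_sphere)
open BubbleTransfer (unitVec)
open GhostTable (gFree free_g_eq)
open TwoPowerLegs (free)
open WindowIdentification (psum fullSum fullSum_eq_tsum_sub)
open DecimatedMomentSummable (AbsMoment₂ absMoment₂_of_decay510)
open GradedBubbles (Fam IsO DG fdiffF iterD IsStep dg_three_free)
open GradedBubbleTerms (ETerm iterD_append iterD_isO iterD_add)
open ScaleLegRows (abs_iterD_flat_nil_le abs_iterD_flat_cons_le abs_iterD_far_nil_le abs_iterD_far_cons_le exists_envelope_iterD abs_apply_zero_le)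
open ScaleLegTermCount (abs_weighted_far_le abs_weighted_window_le abs_fullSum_le_of_window_quintic_tail)

/-! ## §1 The free leg made soft, and the free + flat split of a profile's differences -/

/-- [folklore] **THE FREE LEG, SOFT FORM**: for unit steps `as`, ONE constant `A ≥ 0` with `|∂^{as} gFree (u)| ≤ A/(‖u‖∞+1)^{2 + min |as| 3}` for
ALL `u` (an3's `dg_three_free` up to three differences, crude beyond; `IsO` made soft with `2^p`). -/
theorem exists_soft_iterD_free {as : List Pt} (has : ∀ a ∈ as, IsStep a) :
    ∃ A : ℝ, 0 ≤ A ∧ ∀ (L k : ℕ) (u : Pt), |iterD as free.g L k u| ≤ A / ((supNorm u : ℝ) + 1) ^ (2 + min as.length 3) := by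
  -- `IsO (2 + min |as| 3)` of the iterated difference
  have hO : IsO (2 + min as.length 3) (iterD as free.g) := by
    by_cases hk : as.length ≤ 3
    · rw [min_eq_left hk]
      exact dg_three_free as hk has
    · rw [not_le] at hk
      rw [min_eq_right hk.le, ← List.take_append_drop 3 as, iterD_append]
      have ht : (as.take 3).length = 3 := by rw [List.length_take]; omega
      have h3 : IsO (2 + (as.take 3).length) (iterD (as.take 3) free.g) :=
        dg_three_free (as.take 3) (by rw [ht]) (fun a ha => has a (List.mem_of_mem_take ha))
      rw [ht] at h3
      exact iterD_isO (as.drop 3) h3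
  obtain ⟨A, hA, hglob, hdec⟩ := hO
  set p : ℕ := 2 + min as.length 3
  refine ⟨A * 2 ^ p, by positivity, fun L k u => ?_⟩
  by_cases hu : u = 0
  · subst hu
    have hs : (supNorm (0 : Pt) : ℝ) = 0 := by exact_mod_cast supNorm_eq_zero_iff.mpr rfl
    rw [hs, zero_add, one_pow, div_one]
    exact (hglob L k 0).trans (le_mul_of_one_le_right hA (one_le_pow₀ (by norm_num)))
  · have hs1 : (1 : ℝ) ≤ supNorm u := BubbleTransfer.Leg.one_le_supNorm hu
    refine (hdec L k u hu).trans ?_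
    rw [div_le_div_iff₀ (by positivity) (by positivity), mul_assoc, ← mul_pow]
    exact mul_le_mul_of_nonneg_left (pow_le_pow_left₀ (by positivity) (by linarith) p) hA

/-- [folklore] **THE SPLIT OF A PROFILE'S DIFFERENCES**: `∂^{as}g = ∂^{as}gFree + ∂^{as}(g − gFree)` on constant families. -/
theorem iterD_const_eq_free_add_flat (g : Pt → ℝ) (as : List Pt) (L k : ℕ) (u : Pt) :
    iterD as (fun (_ : ℕ) (_ : ℕ) => g) L k u = iterD as free.g L k u + iterD as (fun (_ : ℕ) (_ : ℕ) => fun v => g v - gFree v) L k u := by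
  have e : (fun (_ : ℕ) (_ : ℕ) => g : Fam) = free.g + (fun (_ : ℕ) (_ : ℕ) => fun v => g v - gFree v) := by
    funext L' k' v
    simp only [Pi.add_apply, free_g_eq]
    ring
  rw [e, iterD_add, Pi.add_apply, Pi.add_apply, Pi.add_apply]

/-- [folklore] **THE FAR LEG, UNIFORM SHAPE** (both arities): under d0∕d1∕h0, for unit steps `as`,
`|∂^{as}g (u)| ≤ (5A₀ + 8A₁ + |gFree 0| + D₀)·8e^δ·(1 + 8e^δ)^{|as|}·e^{−(δ/n)‖u‖∞}/(‖u‖∞+1)^{2 + min |as| 1}`. -/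
theorem abs_iterD_far_le {n : ℕ} (hn : 1 ≤ n) {δ A₀ A₁ D₀ : ℝ} (hδ : 0 ≤ δ) (hA₀ : 0 ≤ A₀) (hA₁ : 0 ≤ A₁) {g : Pt → ℝ}
    (d0 : ∀ v : Pt, v ≠ 0 → |g v| ≤ A₀ * Real.exp (-(δ / n) * supNorm v) / (supNorm v : ℝ) ^ 2)
    (d1 : ∀ v : Pt, v ≠ 0 → ∀ ρ : Fin 4, |g (v + unitVec ρ) - g v| ≤ A₁ * Real.exp (-(δ / n) * supNorm v) / (supNorm v : ℝ) ^ 3)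
    (h0 : ∀ v : Pt, |g v - gFree v| ≤ D₀ / (n : ℝ) ^ 2) {as : List Pt} (has : ∀ a ∈ as, IsStep a) (u : Pt) :
    |iterD as (fun (_ : ℕ) (_ : ℕ) => g) 0 0 u| ≤
      (5 * A₀ + 8 * A₁ + (|gFree 0| + D₀)) * (8 * Real.exp δ) * (1 + 2 ^ 3 * Real.exp δ) ^ as.length *
        Real.exp (-(δ / n) * supNorm u) / ((supNorm u : ℝ) + 1) ^ (2 + min as.length 1) := by
  have hz : 0 ≤ |gFree 0| + D₀ := (abs_nonneg _).trans (abs_apply_zero_le hn h0)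
  have he : (1 : ℝ) ≤ 8 * Real.exp δ := by have := Real.one_le_exp hδ; linarith
  have hq : (1 : ℝ) ≤ 1 + 2 ^ 3 * Real.exp δ := by have := Real.exp_pos δ; linarith
  set E : ℝ := Real.exp (-(δ / n) * supNorm u) with hE
  have hE0 : 0 < E := Real.exp_pos _
  cases as with
  | nil =>
      refine (abs_iterD_far_nil_le hn hA₀ d0 h0 u).trans ?_
      simp only [List.length_nil, pow_zero, mul_one, Nat.min_eq_left (Nat.zero_le 1), add_zero]
      rw [div_le_div_iff_of_pos_right (by positivity)]
      refine mul_le_mul_of_nonneg_right ?_ hE0.le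
      calc 4 * A₀ + (|gFree 0| + D₀) ≤ (5 * A₀ + 8 * A₁ + (|gFree 0| + D₀)) * 1 := by linarith
        _ ≤ (5 * A₀ + 8 * A₁ + (|gFree 0| + D₀)) * (8 * Real.exp δ) := mul_le_mul_of_nonneg_left he (by positivity)
  | cons a as =>
      refine (abs_iterD_far_cons_le hn hδ hA₀ hA₁ d0 d1 h0 (has a (by simp)) (fun b hb => has b (List.mem_cons_of_mem a hb)) u).trans ?_
      simp only [List.length_cons, show min (as.length + 1) 1 = 1 by omega]
      rw [div_le_div_iff_of_pos_right (by positivity), pow_succ]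
      refine mul_le_mul_of_nonneg_right ?_ hE0.le
      have h1 : (8 * A₁ + (A₀ + (|gFree 0| + D₀))) * (8 * Real.exp δ) ≤ (5 * A₀ + 8 * A₁ + (|gFree 0| + D₀)) * (8 * Real.exp δ) :=
        mul_le_mul_of_nonneg_right (by linarith) (by positivity)
      have h2 : (1 + 2 ^ 3 * Real.exp δ) ^ as.length ≤ (1 + 2 ^ 3 * Real.exp δ) ^ as.length * (1 + 2 ^ 3 * Real.exp δ) :=
        le_mul_of_one_le_right (by positivity) hq
      exact mul_le_mul h1 h2 (by positivity) (by positivity)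

/-- [folklore] **THE FLAT LEG, UNIFORM SHAPE** (both arities): under h0∕h1, `|∂^{as}(g − gFree)(u)| ≤ (D₀ + D₁)·2^{|as|}/n^{2 + min |as| 1}`. -/
theorem abs_iterD_flat_le {n : ℕ} (hn : 1 ≤ n) {D₀ D₁ : ℝ} (hD₁ : 0 ≤ D₁) {g : Pt → ℝ}
    (h0 : ∀ v : Pt, |g v - gFree v| ≤ D₀ / (n : ℝ) ^ 2)
    (h1 : ∀ (v : Pt) (ρ : Fin 4), |(g (v + unitVec ρ) - gFree (v + unitVec ρ)) - (g v - gFree v)| ≤ D₁ / (n : ℝ) ^ 3)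
    {as : List Pt} (has : ∀ a ∈ as, IsStep a) (u : Pt) :
    |iterD as (fun (_ : ℕ) (_ : ℕ) => fun v => g v - gFree v) 0 0 u| ≤ (D₀ + D₁) * 2 ^ as.length / (n : ℝ) ^ (2 + min as.length 1) := by
  have hn0 : (0 : ℝ) < n := by exact_mod_cast hn
  have hD₀ : 0 ≤ D₀ := by
    have h := (abs_nonneg _).trans (h0 0)
    have := mul_nonneg h (pow_nonneg hn0.le 2)
    rwa [div_mul_cancel₀ _ (by positivity)] at this
  cases as with
  | nil =>
      refine (abs_iterD_flat_nil_le h0 u).trans ?_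
      simp only [List.length_nil, pow_zero, mul_one, Nat.min_eq_left (Nat.zero_le 1), add_zero]
      exact div_le_div_of_nonneg_right (by linarith) (by positivity)
  | cons a as =>
      refine (abs_iterD_flat_cons_le h1 (has a (by simp)) u).trans ?_
      have h2k : (0 : ℝ) < 2 ^ as.length := by positivity
      have e : (D₀ + D₁) * 2 ^ (a :: as).length / (n : ℝ) ^ (2 + min (a :: as).length 1) = (D₀ + D₁) * (2 ^ as.length * 2) / (n : ℝ) ^ 3 := by
        simp only [List.length_cons, show min (as.length + 1) 1 = 1 by omega, pow_succ]
      rw [e]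
      calc 2 ^ as.length * (D₁ / (n : ℝ) ^ 3) = (D₁ * 2 ^ as.length) / (n : ℝ) ^ 3 := by ring
        _ ≤ (D₀ + D₁) * (2 ^ as.length * 2) / (n : ℝ) ^ 3 := div_le_div_of_nonneg_right (by nlinarith [h2k]) (by positivity)

/-! ## §2 Summability at fixed `n` from exponential envelopes -/

section Summable

variable {P H₁ H₂ : Pt → ℝ} {Cp c C₁ C₂ δ' : ℝ} {m : ℕ} {x y : Pt}

/-- [folklore] `|w|₁ ≤ |x − w|₁ + |x|₁`. -/
theorem l1_le_l1_sub_add (w x : Pt) : l1 w ≤ l1 (x - w) + l1 x := by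
  unfold l1
  rw [← Finset.sum_add_distrib]
  refine Finset.sum_le_sum fun i _ => ?_
  have e : ((w i : ℤ) : ℝ) = ((x i : ℤ) : ℝ) - (((x - w) i : ℤ) : ℝ) := by push_cast [Pi.sub_apply]; ring
  rw [e]
  have := abs_sub ((x i : ℤ) : ℝ) (((x - w) i : ℤ) : ℝ)
  linarith

/-- [folklore] `|w|₁ ≤ |w + y|₁ + |y|₁`. -/
theorem l1_le_l1_add_add (w y : Pt) : l1 w ≤ l1 (w + y) + l1 y := by
  unfold l1
  rw [← Finset.sum_add_distrib]
  refine Finset.sum_le_sum fun i _ => ?_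
  have e : ((w i : ℤ) : ℝ) = (((w + y) i : ℤ) : ℝ) - ((y i : ℤ) : ℝ) := by push_cast [Pi.add_apply]; ring
  rw [e]
  exact abs_sub _ _

/-- [folklore] **SUMMABILITY OF A WEIGHTED LOCATED PRODUCT** from `ℓ¹`-exponential envelopes of the legs (`δ' > 0`) and a weight of degree `≤ 2`. -/
theorem summable_weighted_of_envelopes (hδ' : 0 < δ') (hP : ∀ w : Pt, |P w| ≤ Cp * ((supNorm w : ℝ) + 1) ^ m) (hm : m ≤ 2)
    (h₁ : ∀ u : Pt, |H₁ u| ≤ C₁ * Real.exp (-δ' * l1 u)) (h₂ : ∀ u : Pt, |H₂ u| ≤ C₂ * Real.exp (-δ' * l1 u)) :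
    Summable (fun w : Pt => P w * (c * (H₁ (x - w) * H₂ (w + y)))) := by
  have hCp : 0 ≤ Cp := by
    have h := hP 0
    have hs : (supNorm (0 : Pt) : ℝ) = 0 := by exact_mod_cast supNorm_eq_zero_iff.mpr rfl
    rw [hs, zero_add, one_pow, mul_one] at h
    exact (abs_nonneg _).trans h
  have hC₁ : 0 ≤ C₁ := by have h := h₁ 0; simp [l1] at h; exact (abs_nonneg _).trans h
  have hC₂ : 0 ≤ C₂ := by have h := h₂ 0; simp [l1] at h; exact (abs_nonneg _).trans h
  -- the majorant `M·(1 + |w|₁²)·e^{−δ'|w|₁}` is summable (Decay510 ⇒ AbsMoment₂)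
  have hdec : Decay510 (fun w : Pt => Real.exp (-δ' * l1 w)) 1 δ' := fun w => by
    rw [abs_of_pos (Real.exp_pos _), one_mul]
  have hAM : AbsMoment₂ (fun w : Pt => Real.exp (-δ' * l1 w)) := absMoment₂_of_decay510 hδ' hdec
  set M : ℝ := Cp * 4 * (|c| * (C₁ * Real.exp (δ' * l1 x) * (C₂ * Real.exp (δ' * l1 y)))) with hM
  have hM0 : 0 ≤ M := by positivity
  have hmaj : Summable (fun w : Pt => M * ((1 + l1 w ^ 2) * |Real.exp (-δ' * l1 w)|)) := hAM.mul_left M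
  refine Summable.of_norm_bounded hmaj (fun w => ?_)
  rw [Real.norm_eq_abs, abs_mul, abs_mul, abs_mul, abs_of_pos (Real.exp_pos _)]
  -- the legs at the shifted arguments
  have hl₁ : l1 w ≤ l1 (x - w) + l1 x := l1_le_l1_sub_add w x
  have hl₂ : l1 w ≤ l1 (w + y) + l1 y := l1_le_l1_add_add w y
  have g₁ : |H₁ (x - w)| ≤ C₁ * Real.exp (δ' * l1 x) * Real.exp (-δ' * l1 w) := by
    refine (h₁ _).trans ?_
    rw [mul_assoc, ← Real.exp_add]
    exact mul_le_mul_of_nonneg_left (Real.exp_le_exp.mpr (by nlinarith)) hC₁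
  have g₂ : |H₂ (w + y)| ≤ C₂ * Real.exp (δ' * l1 y) * Real.exp (-δ' * l1 w) := by
    refine (h₂ _).trans ?_
    rw [mul_assoc, ← Real.exp_add]
    exact mul_le_mul_of_nonneg_left (Real.exp_le_exp.mpr (by nlinarith)) hC₂
  -- the weight: `(‖w‖∞+1)^m ≤ (|w|₁+1)² ≤ 2(1 + |w|₁²)` … absorbed with one `e^{−δ'|w|₁} ≤ 1`
  -- `‖w‖∞ ≤ |w|₁` (the tree's `FP.LegPairingBounds.supNorm_le_l1`, re-derived inline to keep this module's imports light)
  have hsl : (supNorm w : ℝ) ≤ l1 w := by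
    obtain ⟨i, hi⟩ := DyadicShell.exists_eq_supNorm w
    have h := abs_coord_le_l1 w i
    have e : (((w i).natAbs : ℕ) : ℝ) = |((w i : ℤ) : ℝ)| := by rw [Nat.cast_natAbs, Int.cast_abs]
    rw [← hi, e]
    exact h
  have hl0 := l1_nonneg w
  have gP : |P w| ≤ Cp * 4 * (1 + l1 w ^ 2) := by
    refine (hP w).trans ?_
    have h1 : ((supNorm w : ℝ) + 1) ^ m ≤ (l1 w + 1) ^ m := pow_le_pow_left₀ (by positivity) (by linarith) m
    have h2 : (l1 w + 1) ^ m ≤ (l1 w + 1) ^ 2 := pow_le_pow_right₀ (by linarith) hm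
    have h3 : (l1 w + 1) ^ 2 ≤ 4 * (1 + l1 w ^ 2) := by nlinarith
    calc Cp * ((supNorm w : ℝ) + 1) ^ m ≤ Cp * (4 * (1 + l1 w ^ 2)) := mul_le_mul_of_nonneg_left (h1.trans (h2.trans h3)) hCp
      _ = Cp * 4 * (1 + l1 w ^ 2) := by ring
  have hE1 : Real.exp (-δ' * l1 w) ≤ 1 := Real.exp_le_one_iff.mpr (by nlinarith)
  have hE0 : 0 < Real.exp (-δ' * l1 w) := Real.exp_pos _
  calc |P w| * (|c| * (|H₁ (x - w)| * |H₂ (w + y)|))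
      ≤ (Cp * 4 * (1 + l1 w ^ 2)) * (|c| * ((C₁ * Real.exp (δ' * l1 x) * Real.exp (-δ' * l1 w)) * (C₂ * Real.exp (δ' * l1 y) * Real.exp (-δ' * l1 w)))) := by
        gcongr
    _ = M * ((1 + l1 w ^ 2) * Real.exp (-δ' * l1 w)) * Real.exp (-δ' * l1 w) := by rw [hM]; ring
    _ ≤ M * ((1 + l1 w ^ 2) * Real.exp (-δ' * l1 w)) * 1 := by gcongr
    _ = M * ((1 + l1 w ^ 2) * Real.exp (-δ' * l1 w)) := mul_one _

end Summable

/-- [folklore] **EVERY weighted elementary term is summable at fixed `n`** (no admissibility needed): unit steps, weight of degree `≤ 2`, rows d0∕d1∕h0. -/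
theorem summable_weight_eval (t : ETerm) (ht : ∀ a ∈ t.as₁ ++ t.as₂, IsStep a) {m : ℕ} (hm2 : m ≤ 2) {Cp δ A₀ A₁ D₀ : ℝ} (hδ : 0 < δ)
    (hA₀ : 0 ≤ A₀) (hA₁ : 0 ≤ A₁) {n : ℕ} (hn : 1 ≤ n) {g : Pt → ℝ}
    (d0 : ∀ v : Pt, v ≠ 0 → |g v| ≤ A₀ * Real.exp (-(δ / n) * supNorm v) / (supNorm v : ℝ) ^ 2)
    (d1 : ∀ v : Pt, v ≠ 0 → ∀ ρ : Fin 4, |g (v + unitVec ρ) - g v| ≤ A₁ * Real.exp (-(δ / n) * supNorm v) / (supNorm v : ℝ) ^ 3)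
    (h0 : ∀ v : Pt, |g v - gFree v| ≤ D₀ / (n : ℝ) ^ 2) {P : Pt → ℝ} (hP : ∀ w : Pt, |P w| ≤ Cp * ((supNorm w : ℝ) + 1) ^ m) :
    Summable (fun w : Pt => P w * t.eval (fun _ _ => g) (fun _ _ => g) 0 0 w) := by
  obtain ⟨c, x, y, as₁, as₂⟩ := t
  have has₁ : ∀ a ∈ as₁, IsStep a := fun a ha => ht a (List.mem_append_left _ ha)
  have has₂ : ∀ a ∈ as₂, IsStep a := fun a ha => ht a (List.mem_append_right _ ha)
  obtain ⟨E₁, -, hE₁⟩ := exists_envelope_iterD hn hδ.le hA₀ hA₁ d0 d1 h0 has₁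
  obtain ⟨E₂, -, hE₂⟩ := exists_envelope_iterD hn hδ.le hA₀ hA₁ d0 d1 h0 has₂
  have hδ' : 0 < δ / n / 4 := by
    have hn0 : (0 : ℝ) < n := by exact_mod_cast hn
    positivity
  have h := summable_weighted_of_envelopes (c := c) (x := x) (y := y) hδ' hP hm2 hE₁ hE₂
  refine h.congr fun w => ?_
  simp only [ETerm.eval]

/-! ## §3 One admissible weighted term: summable, and its full sum ∕ `tsum` bounded UNIFORMLY in the scale -/

section Term

/-- [folklore] **THE ADMISSIBLE TERM BOUND.**  Fix an elementary term `t` with unit steps, a weight class `(Cp, m)` with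
`m ≤ min(|as₁|,1) + min(|as₂|,1)`, `m + 1 ≤ |as₁| + |as₂|`, `m ≤ 2`, and row constants `δ > 0`, `A₀, A₁, D₀, D₁ ≥ 0`.  Then ONE `B ≥ 0` serves
every scale `n ≥ 1`, every profile `g` obeying the four rows d0∕d1∕h0∕h1 at scale `n` with these constants, and every weight `|P w| ≤ Cp(‖w‖∞+1)^m`:
`w ↦ P(w)·t.eval g g (w)` is summable, `|fullSum| ≤ B` and `|Σ'| ≤ B`. -/
theorem exists_bound_weight_eval (t : ETerm) (ht : ∀ a ∈ t.as₁ ++ t.as₂, IsStep a) {m : ℕ}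
    (hm₁ : m ≤ min t.as₁.length 1 + min t.as₂.length 1) (hm₂ : m + 1 ≤ t.len) (hm2 : m ≤ 2)
    {Cp δ A₀ A₁ D₀ D₁ : ℝ} (hCp : 0 ≤ Cp) (hδ : 0 < δ) (hA₀ : 0 ≤ A₀) (hA₁ : 0 ≤ A₁) (hD₀ : 0 ≤ D₀) (hD₁ : 0 ≤ D₁) :
    ∃ B : ℝ, 0 ≤ B ∧ ∀ (n : ℕ), 1 ≤ n → ∀ (g : Pt → ℝ),
      (∀ v : Pt, v ≠ 0 → |g v| ≤ A₀ * Real.exp (-(δ / n) * supNorm v) / (supNorm v : ℝ) ^ 2) →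
      (∀ v : Pt, v ≠ 0 → ∀ ρ : Fin 4, |g (v + unitVec ρ) - g v| ≤ A₁ * Real.exp (-(δ / n) * supNorm v) / (supNorm v : ℝ) ^ 3) →
      (∀ v : Pt, |g v - gFree v| ≤ D₀ / (n : ℝ) ^ 2) →
      (∀ (v : Pt) (ρ : Fin 4), |(g (v + unitVec ρ) - gFree (v + unitVec ρ)) - (g v - gFree v)| ≤ D₁ / (n : ℝ) ^ 3) →
      ∀ (P : Pt → ℝ), (∀ w : Pt, |P w| ≤ Cp * ((supNorm w : ℝ) + 1) ^ m) →
        Summable (fun w : Pt => P w * t.eval (fun _ _ => g) (fun _ _ => g) 0 0 w) ∧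
        |fullSum (fun w : Pt => P w * t.eval (fun _ _ => g) (fun _ _ => g) 0 0 w)| ≤ B ∧
        |∑' w : Pt, P w * t.eval (fun _ _ => g) (fun _ _ => g) 0 0 w| ≤ B := by
  obtain ⟨c, x, y, as₁, as₂⟩ := t
  have has₁ : ∀ a ∈ as₁, IsStep a := fun a ha => ht a (List.mem_append_left _ ha)
  have has₂ : ∀ a ∈ as₂, IsStep a := fun a ha => ht a (List.mem_append_right _ ha)
  simp only [ETerm.len] at hm₂
  simp only at hm₁
  -- the free-leg constants (fixed before the scale)
  obtain ⟨AF₁, hAF₁, hF₁⟩ := exists_soft_iterD_free has₁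
  obtain ⟨AF₂, hAF₂, hF₂⟩ := exists_soft_iterD_free has₂
  -- exponents
  set k₁ : ℕ := as₁.length with hk₁
  set k₂ : ℕ := as₂.length with hk₂
  set p₁ : ℕ := 2 + min k₁ 1 with hp₁
  set p₂ : ℕ := 2 + min k₂ 1 with hp₂
  set q₁ : ℕ := 2 + min k₁ 3 with hq₁
  set q₂ : ℕ := 2 + min k₂ 3 with hq₂
  have hpp : m + 4 ≤ p₁ + p₂ := by omega
  have hqq : m + 5 ≤ q₁ + q₂ := by omega
  have hqp : m + 4 ≤ q₁ + p₂ := by omega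
  have hpq : m + 4 ≤ p₁ + q₂ := by omega
  have hp₁1 : 1 ≤ p₁ := by omega
  have hp₂1 : 1 ≤ p₂ := by omega
  -- n-free constants
  set Bu : ℝ := (5 * A₀ + 8 * A₁ + (|gFree 0| + D₀)) * (8 * Real.exp δ) with hBu
  have hBu0 : 0 ≤ Bu := by positivity
  set Bf₁ : ℝ := Bu * (1 + 2 ^ 3 * Real.exp δ) ^ k₁ with hBf₁
  set Bf₂ : ℝ := Bu * (1 + 2 ^ 3 * Real.exp δ) ^ k₂ with hBf₂
  set Df₁ : ℝ := (D₀ + D₁) * 2 ^ k₁ with hDf₁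
  set Df₂ : ℝ := (D₀ + D₁) * 2 ^ k₂ with hDf₂
  set Et : ℝ := Cp * |c| * (Bf₁ * (Real.exp (δ * supNorm x) * ((supNorm x : ℝ) + 1) ^ p₁)) *
    (Bf₂ * (Real.exp (δ * supNorm y) * ((supNorm y : ℝ) + 1) ^ p₂)) with hEt
  have hEt0 : 0 ≤ Et := by positivity
  set C₁ : ℝ := Cp * |c| * 2 ^ m * (AF₁ * ((supNorm x : ℝ) + 1) ^ q₁ * Df₂ + Df₁ * (AF₂ * ((supNorm y : ℝ) + 1) ^ q₂) + Df₁ * Df₂) with hC₁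
  set C₂ : ℝ := Cp * |c| * 2 ^ m * (AF₁ * ((supNorm x : ℝ) + 1) ^ q₁ * (AF₂ * ((supNorm y : ℝ) + 1) ^ q₂)) with hC₂
  have hC₁0 : 0 ≤ C₁ := by positivity
  have hC₂0 : 0 ≤ C₂ := by positivity
  refine ⟨80 * C₁ + 160 * C₂ + 80 * Et * (1 + 1 / δ) + Et, by positivity, fun n hn g d0 d1 h0 h1 P hP => ?_⟩
  have hn0 : (0 : ℝ) < n := by exact_mod_cast hn
  -- the legs at scale `n`
  set H₁ : Pt → ℝ := fun u => iterD as₁ (fun (_ : ℕ) (_ : ℕ) => g) 0 0 u with hH₁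
  set H₂ : Pt → ℝ := fun u => iterD as₂ (fun (_ : ℕ) (_ : ℕ) => g) 0 0 u with hH₂
  have eK : (fun w : Pt => P w * ETerm.eval (fun _ _ => g) (fun _ _ => g) ⟨c, x, y, as₁, as₂⟩ 0 0 w) =
      fun w : Pt => P w * (c * (H₁ (x - w) * H₂ (w + y))) := by
    funext w; simp only [ETerm.eval, hH₁, hH₂]
  rw [eK]
  have far₁ : ∀ u : Pt, |H₁ u| ≤ Bf₁ * Real.exp (-(δ / n) * supNorm u) / ((supNorm u : ℝ) + 1) ^ p₁ := fun u =>
    abs_iterD_far_le hn hδ.le hA₀ hA₁ d0 d1 h0 has₁ u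
  have far₂ : ∀ u : Pt, |H₂ u| ≤ Bf₂ * Real.exp (-(δ / n) * supNorm u) / ((supNorm u : ℝ) + 1) ^ p₂ := fun u =>
    abs_iterD_far_le hn hδ.le hA₀ hA₁ d0 d1 h0 has₂ u
  have flat₁ : ∀ u : Pt, |iterD as₁ (fun (_ : ℕ) (_ : ℕ) => fun v => g v - gFree v) 0 0 u| ≤ Df₁ / (n : ℝ) ^ p₁ := fun u =>
    abs_iterD_flat_le hn hD₁ h0 h1 has₁ u
  have flat₂ : ∀ u : Pt, |iterD as₂ (fun (_ : ℕ) (_ : ℕ) => fun v => g v - gFree v) 0 0 u| ≤ Df₂ / (n : ℝ) ^ p₂ := fun u =>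
    abs_iterD_flat_le hn hD₁ h0 h1 has₂ u
  -- TAIL: every `w`
  have hBf₁0 : 0 ≤ Bf₁ := by positivity
  have hBf₂0 : 0 ≤ Bf₂ := by positivity
  have tail : ∀ w : Pt, |P w * (c * (H₁ (x - w) * H₂ (w + y)))| ≤ Et * Real.exp (-(δ / n) * supNorm w) / ((supNorm w : ℝ) + 1) ^ 4 :=
    fun w => abs_weighted_far_le hn hδ.le hCp hP hBf₁0 hBf₂0 far₁ far₂ hpp w
  have htail : ∀ r : ℕ, n - 1 ≤ r → ∀ w ∈ annulus 4 r (r + 1),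
      |P w * (c * (H₁ (x - w) * H₂ (w + y)))| ≤ Et / ((r : ℝ) + 1) ^ 4 * Real.exp (-(δ / (n : ℝ)) * ((r : ℝ) + 1)) := by
    intro r _ w hw
    have hsw : (supNorm w : ℝ) = (r : ℝ) + 1 := by rw [supNorm_eq_of_mem_sphere hw]; push_cast; ring
    refine (tail w).trans ?_
    rw [hsw]
    have hr0 : (0 : ℝ) < (r : ℝ) + 1 := by positivity
    have hE0 : 0 < Real.exp (-(δ / (n : ℝ)) * ((r : ℝ) + 1)) := Real.exp_pos _
    rw [div_le_iff₀ (by positivity)]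
    calc Et * Real.exp (-(δ / n) * ((r : ℝ) + 1)) = Et / ((r : ℝ) + 1) ^ 4 * Real.exp (-(δ / n) * ((r : ℝ) + 1)) * ((r : ℝ) + 1) ^ 4 := by
          field_simp
      _ ≤ Et / ((r : ℝ) + 1) ^ 4 * Real.exp (-(δ / n) * ((r : ℝ) + 1)) * ((r : ℝ) + 1 + 1) ^ 4 := by
          gcongr
          linarith
  -- WINDOW: shells `r + 1 ≤ n`
  have hwin : ∀ r : ℕ, r + 1 ≤ n → ∀ w ∈ annulus 4 r (r + 1),
      |P w * (c * (H₁ (x - w) * H₂ (w + y)))| ≤ C₁ / (((r : ℝ) + 1) ^ 3 * (n : ℝ)) + C₂ / ((r : ℝ) + 1) ^ 5 := by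
    intro r hr w hw
    exact abs_weighted_window_le hn hCp hP (H₁ := H₁) (H₂ := H₂) (x := x) (y := y) (c := c)
      (fun u => iterD_const_eq_free_add_flat g as₁ 0 0 u) (fun u => iterD_const_eq_free_add_flat g as₂ 0 0 u)
      hAF₁ hAF₂ (by positivity : (0 : ℝ) ≤ Df₁) (by positivity : (0 : ℝ) ≤ Df₂)
      (fun u => hF₁ 0 0 u) (fun u => hF₂ 0 0 u) flat₁ flat₂ hqq hqp hpq hpp hp₁1 hp₂1 hr hw
  have hfull := abs_fullSum_le_of_window_quintic_tail hn hC₁0 hC₂0 hEt0 hδ hwin htail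
  -- SUMMABLE at fixed `n`
  obtain ⟨E₁, -, hE₁⟩ := exists_envelope_iterD hn hδ.le hA₀ hA₁ d0 d1 h0 has₁
  obtain ⟨E₂, -, hE₂⟩ := exists_envelope_iterD hn hδ.le hA₀ hA₁ d0 d1 h0 has₂
  have hδ' : 0 < δ / n / 4 := by positivity
  have hsum : Summable (fun w : Pt => P w * (c * (H₁ (x - w) * H₂ (w + y)))) :=
    summable_weighted_of_envelopes hδ' hP hm2 hE₁ hE₂
  -- the origin value and the `tsum`
  have h0v : |P 0 * (c * (H₁ (x - 0) * H₂ (0 + y)))| ≤ Et := by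
    refine (tail 0).trans ?_
    have hs : (supNorm (0 : Pt) : ℝ) = 0 := by exact_mod_cast supNorm_eq_zero_iff.mpr rfl
    rw [hs, mul_zero, Real.exp_zero, zero_add, one_pow, mul_one, div_one]
  refine ⟨hsum, hfull.trans (by linarith), ?_⟩
  rw [show (∑' w : Pt, P w * (c * (H₁ (x - w) * H₂ (w + y)))) =
      fullSum (fun w : Pt => P w * (c * (H₁ (x - w) * H₂ (w + y)))) + P 0 * (c * (H₁ (x - 0) * H₂ (0 + y))) by
    rw [fullSum_eq_tsum_sub _ hsum]; ring]
  calc |fullSum (fun w : Pt => P w * (c * (H₁ (x - w) * H₂ (w + y)))) + P 0 * (c * (H₁ (x - 0) * H₂ (0 + y)))|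
      ≤ |fullSum (fun w : Pt => P w * (c * (H₁ (x - w) * H₂ (w + y))))| + |P 0 * (c * (H₁ (x - 0) * H₂ (0 + y)))| := abs_add_le _ _
    _ ≤ (80 * C₁ + 160 * C₂ + 80 * Et * (1 + 1 / δ)) + Et := add_le_add hfull h0v

end Term

end Summit.QuantumFields.BalabanUV.Beta.D1BFx.ScaleLegTermBound

end
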